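import Summits.BirchSwinnertonDyer.BirchSwinnertonDyer.Theorems.ResidualThetaTransportAtTwoResidualSignedLambdaLowerCMAtTwoCofreeAdmissible
import Summits.BirchSwinnertonDyer.BirchSwinnertonDyer.Theorems.ResidualThetaTransportAtTwoResidualSignedLambdaLowerCMAtTwoCofreeShapiroTransport
import Summits.BirchSwinnertonDyer.BirchSwinnertonDyer.Theorems.ResidualThetaTransportAtTwoThetaTransportResidualUnramified
import Summits.BirchSwinnertonDyer.BirchSwinnertonDyer.Theorems.ResidualThetaTransportAtTwoThetaTransportResidualArchimedean
import Summits.BirchSwinnertonDyer.BirchSwinnertonDyer.Theorems.ResidualThetaTransportAtTwoUnramifiedRestriction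
import Literature.NumberTheory.GaloisRepresentations.EulerSystemGaloisAction
import Literature.NumberTheory.GaloisRepresentations.DecompositionGroupOfCompletion
import Literature.NumberTheory.GaloisRepresentations.OneCocycleRestrictionKernelCountProofs
import HarnessLib

/-!
# The `ρ`-coefficient TRANSFER `τ_{n,N} = res_{Γ_∞ ≤ Γ_n} ∘ (A_ρ[N] ↪ A_ρ)_*` of a finite-level class into `H¹(Γ_∞, A_ρ)` and the
# first two clauses of RSL_g's counted set: (T)_ρ = T1 [unr] ∧ T2 [inf] (∧ T3 [away, item 7]) — typed and proved

Route `ResidualThetaTransportAtTwo` (RTT), crux RSL_g `ResidualSignedLambdaLowerCMAtTwo` (stmt-BirchSwinnertonDyer-22608), line «onepair»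
(skeleton v2c/v2d), S57 split items 6 (S4₂ `stub_deepHalfAtTwoStrict`) / 7 (S4₀ `stub_deepHalfAwayTwo`); seat `prover-bsd-wall-tp2-p2x-w2` g19
(`--supports`, closes nothing). THEOREMS ONLY (no definition, no named fact, no instance, no `sorry`). STUB-PLAN rev 19 Q79 / S78 (credit:
stub-ideation card k3-g13). BSD is not proved by any of this; RSL_g (22608) and (R≥)ᵖ (26074) stay OPEN.

-- adapted from `Cruxes/ResidualThetaCountLowerPureAtTwo/Sketch_sidea_k3_g13.lean` §0–§4b, §6 (stub-ideation k3 g13, kernel-checked there): the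
-- namespace is moved under `Theorems.ThetaTransport.CofreeSelmerTransfer`; the sketch's `abbrev transferH1` is NOT declared — every statement
-- SPELLS the composite `resOfLe (Cofree ρ F) (κ.kerSubgroup_le_layerSubgroup n) (pushH1 (κ.layerSubgroup n) (A_ρ[N]).subtype _ b)` (THEOREMS-only
-- landing, as the critic asked); the CG / T3♭ residue of the card is NOT here (S78: the item-6 residue is the Kummer-witness TRANSPORT T3♮, landed
-- separately as `…CofreeSelmerTransferKummer.lean`); statements and proofs otherwise unchanged.

WHAT. Both split items carry a Λ-adic hypothesis quantified over the RELAXED Selmer set over `ℚ_∞` while their interior (one `SelmerComplement`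
call per `(n,k)` over `K = ℚ` on `Maps(Γ_ℚ ⧸ Γ_n, A_ρ[2^k])`, then Kőnig) produces level classes whose Shapiro lift lies in the DUAL structure.
Between the two stands `τ_{n,N} : H¹(Γ_n, A_ρ[N]) → H¹(Γ_∞, A_ρ)` and

  (T)_ρ  «a level class whose Shapiro lift is (E1a) ADMISSIBLE outside `S' ⊆ S₀ ∪ {v ∣ p}`, (E1c) trivial on `Γ_n ∩ D_w` for `w ∣ ∞` after every
         conjugation, [item 7: (E1b) the same on `Γ_n ∩ D_v`, `v ∣ p`] is carried by `τ` INTO clause (1) `unramifiedOutside Γ_∞ A_ρ p S₀`,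
         clause (2) `∀ w σ, conj_σ · ∈ infKer Γ_∞ A_ρ w` (VERBATIM the first two clauses of RSL_g's counted set), [and (3′) `∀ σ, conj_σ · ∈
         awayKer Γ_∞ A_ρ v`]».

* §0 generic bridges (any number field, any `H ≤ Γ_K`, any discrete module): B1 `mem_unramifiedKer_of_resOfLe_inertia_inf_eq_zero`,
  RES-PUSH-ZERO `resOfLe_inf_resOfLe_pushH1_eq_zero`, `conjH1_resOfLe`, B2 `exists_rep_vanishing_of_resOfLe_inf_eq_zero` (a representative
  VANISHING on `H ⊓ D`), B3 `kummer_identity_zero_point`.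
* §1 `torsionBy_subtype_smul` (the equivariance feeding `pushH1`).
* §2 T1 [unr]: L1 **`mem_unramifiedOutside_of_admissible`** (Kato ⟹ Greenberg–Vatsal, CONVERSE of the landed
  `ThetaTransport.admissible_of_mem_unramifiedOutside`), **`transferH1_mem_unramifiedOutside`**.
* §3 `resOfLe_inf_conjH1_transferH1_eq_zero` (generic `D`), T2 **`conjH1_transferH1_mem_infKer`**, T3 **`conjH1_transferH1_mem_awayKer`**,
  `exists_rep_vanishing_conjH1_transferH1` (item 7: clause (3) of RSL_g then holds with the ZERO points, B3).
* §4 **`transferH1_mem_relaxed`** (items 6/7), **`transferH1_mem_relaxed_strict`** (item 7); §4b the composites with the landed Shapiro transports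
  (`…CofreeShapiroTransport`): **`transferH1_mem_relaxed_of_shapiroLift`**, **`transferH1_mem_relaxed_strict_of_shapiroLift`** — hypotheses = LOCAL
  CONDITIONS on `Sh c` (membership in the DUAL structure of the level call), conclusion = `τ c ∈` relaxed set over `ℚ_∞` [+ strict at `p`].
* §5 `zsmul_transferH1_eq_zero` (`N • τ b = 0`).

References: [GreenbergVatsal2000] §2 pp. 16–17, 23; [Greenberg1989] §1 p. 98 (3); [Kato2004Asterisque] §8.2 (p. 181), §13.8;
[NeukirchSchmidtWingberg2008] I §5 (1.5.2)–(1.5.4), I §6 (1.6.4); [SerreGaloisCohomology1997] I §2.4–2.6, §5.1; [MilneADT2006] I 4.10 (b);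
[PerrinRiou1995Asterisque] §1.3; [EmertonPollackWeston2006] §3.1; [NeukirchANT1999] Ch. II §9 (9.6).
-/
set_option autoImplicit false
set_option linter.dupNamespace false

noncomputable section

open scoped Classical NumberField

namespace Summit.BirchSwinnertonDyer.BirchSwinnertonDyer.Theorems.ThetaTransport.CofreeSelmerTransfer

open Field IsDedekindDomain NumberField
  Literature.NumberTheory.EllipticCurves Literature.NumberTheory.GaloisRepresentations
  Literature.NumberTheory.EllipticCurves.GreenbergSelmer Literature.NumberTheory.EllipticCurves.GreenbergVatsal2000
  Literature.NumberTheory.EllipticCurves.Kato2004 ZpExtension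
  Summit.BirchSwinnertonDyer.BirchSwinnertonDyer.Theorems

/-! ## §0 Generic bridges (any number field `K`, any `H ≤ Γ_K`, any discrete `Γ_K`-module) -/

section Generic

universe u

variable {K : Type u} [Field K] [NumberField K]
  {M : Type u} [AddCommGroup M] [DistribMulAction (absoluteGaloisGroup K) M] [TopologicalSpace M] [DiscreteTopology M]
  {M' : Type u} [AddCommGroup M'] [DistribMulAction (absoluteGaloisGroup K) M'] [TopologicalSpace M'] [DiscreteTopology M']

/-- **B1 (cocycle bridge).** If `c ∈ H¹(H, M)` dies on `H ⊓ I` for a subgroup `I ⊇ I_v = GreenbergSelmer.inertia v`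
(e.g. `I = I_{𝔓₀(v)}`, the inertia group of the completion prime), then `c ∈ unramifiedKer H M v`
(both sides say «the cocycle is a coboundary on `H ∩ I_v`»). [cite: GreenbergVatsal2000, §2 p. 17] [cite: SerreGaloisCohomology1997, I §5.1] -/
theorem mem_unramifiedKer_of_resOfLe_inertia_inf_eq_zero (H : Subgroup (absoluteGaloisGroup K))
    (v : HeightOneSpectrum (𝓞 K)) {I : Subgroup (absoluteGaloisGroup K)} (hI : GreenbergSelmer.inertia (K := K) v ≤ I)
    {c : subgroupH1 H M} (hc : resOfLe M (inf_le_left : H ⊓ I ≤ H) c = 0) :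
    c ∈ unramifiedKer H M v := by
  obtain ⟨φ, rfl⟩ := oneCocycleClass_surjective _ c
  rw [CocycleCriteria.resOfLe_oneCocycleClass_eq_zero_iff] at hc
  obtain ⟨a, ha⟩ := hc
  rw [ResidualLayer.oneCocycleClass_mem_unramifiedKer_iff]
  refine ⟨a, fun x ↦ ?_⟩
  obtain ⟨hxH, hxI⟩ := (mem_inertiaIn_iff H v _).1 x.2
  have h := ha ⟨((x : decomp (K := K) v) : absoluteGaloisGroup K), Subgroup.mem_inf.2 ⟨hxH, hI hxI⟩⟩
  have e : inertiaInToH H v x =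
      Subgroup.inclusion (inf_le_left : H ⊓ I ≤ H)
        ⟨((x : decomp (K := K) v) : absoluteGaloisGroup K), Subgroup.mem_inf.2 ⟨hxH, hI hxI⟩⟩ :=
    Subtype.ext rfl
  rw [e, h]
  rfl

omit [NumberField K] in
/-- **RES-PUSH-ZERO (generic).** For `H₀ ≤ H ≤ Γ_K` (`H` normal), a subgroup `D ≤ Γ_K` and an equivariant
`i : M → M'`: if `y ∈ H¹(H, M)` dies on `H ⊓ D` then `res_{H₀} (i_* y)` dies on `H₀ ⊓ D`.
[cite: SerreGaloisCohomology1997, I §2.4] [cite: NeukirchSchmidtWingberg2008, I §5] -/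
theorem resOfLe_inf_resOfLe_pushH1_eq_zero {H H₀ : Subgroup (absoluteGaloisGroup K)} [H.Normal] (h : H₀ ≤ H)
    (D : Subgroup (absoluteGaloisGroup K)) (i : M →+ M') (hi : ∀ (g : absoluteGaloisGroup K) (x : M), i (g • x) = g • i x)
    {y : subgroupH1 H M} (hy : resOfLe M (inf_le_left : H ⊓ D ≤ H) y = 0) :
    resOfLe M' (inf_le_left : H₀ ⊓ D ≤ H₀) (resOfLe M' h (pushH1 H i hi y)) = 0 := by
  -- `res_{H₀ ⊓ D}^{H₀} ∘ res_{H₀}^{H} = res_{H₀ ⊓ D}^{H ⊓ D} ∘ res_{H ⊓ D}^{H}`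
  have e1 := congrArg (fun f ↦ f (pushH1 H i hi y)) (resOfLe_comp_holds (M := M') (inf_le_left : H₀ ⊓ D ≤ H₀) h)
  have e2 := congrArg (fun f ↦ f (pushH1 H i hi y)) (resOfLe_comp_holds (M := M')
    (inf_le_inf_right D h : H₀ ⊓ D ≤ H ⊓ D) (inf_le_left : H ⊓ D ≤ H))
  simp only [AddMonoidHom.coe_comp, Function.comp_apply] at e1 e2
  rw [e1, ← e2, ThetaTransport.resOfLe_pushH1 i hi inf_le_left y, hy, map_zero, map_zero]

omit [NumberField K] in
/-- `conj_σ ∘ res = res ∘ conj_σ` applied to a class. [cite: NeukirchSchmidtWingberg2008, I §5] -/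
theorem conjH1_resOfLe {H H₀ : Subgroup (absoluteGaloisGroup K)} [H.Normal] [H₀.Normal] (h : H₀ ≤ H)
    (σ : absoluteGaloisGroup K) (y : subgroupH1 H M) :
    conjH1 H₀ M σ (resOfLe M h y) = resOfLe M h (conjH1 H M σ y) := by
  have e := congrArg (fun f ↦ f y) (resOfLe_comp_conjH1_holds (M := M) h σ)
  simp only [AddMonoidHom.coe_comp, Function.comp_apply] at e
  exact e.symm

omit [NumberField K] in
/-- **B2 (normalised representative).** If the stabilisers of `M` are open and `y ∈ H¹(H, M)` dies on `H ⊓ D`, then `y` has a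
representative cocycle VANISHING on `H ⊓ D` (subtract the principal cocycle; `exists_oneCocycleClass_eq_and_forall_mem_eq_zero`).
Use (item 7, clause (3)/(3♭) of RSL_g's sets): with such a representative `ψ` of `conj_σ (τ b) ∈ awayKer Γ_∞ A_ρ v` the Kummer
identity `Θ(ψ(r τ)) ↦ τ • Q − Q` holds with the ZERO points `Q = 0` (B3), so a class strict at `2` satisfies even the SIGNED clause.
[cite: SerreGaloisCohomology1997, I §2.6 (b)] [cite: Greenberg1989, §1 p. 98] -/
theorem exists_rep_vanishing_of_resOfLe_inf_eq_zero (H D : Subgroup (absoluteGaloisGroup K))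
    (hM : ∀ m : M, IsOpen (MulAction.stabilizer (absoluteGaloisGroup K) m : Set (absoluteGaloisGroup K)))
    {y : subgroupH1 H M} (hy : resOfLe M (inf_le_left : H ⊓ D ≤ H) y = 0) :
    ∃ ψ : contOneCocycles (discreteTopRep H M), oneCocycleClass _ ψ = y ∧
      ∀ g : H, (g : absoluteGaloisGroup K) ∈ D → ψ.1 g = 0 := by
  obtain ⟨φ, rfl⟩ := oneCocycleClass_surjective _ y
  rw [CocycleCriteria.resOfLe_oneCocycleClass_eq_zero_iff] at hy
  obtain ⟨a, ha⟩ := hy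
  have hX : ∀ v : M, Continuous fun g : H ↦ (discreteTopRep H M).ρ g v := fun v ↦
    ((continuous_smul_of_isOpen_stabilizer v (hM v)).comp continuous_subtype_val).congr fun _ ↦ rfl
  have hφ : ∃ φ' : contOneCocycles (discreteTopRep H M), oneCocycleClass _ φ' = oneCocycleClass _ φ ∧
      ∃ v : M, ∀ s ∈ D.subgroupOf H, φ'.1 s = (discreteTopRep H M).ρ s v - v := by
    refine ⟨φ, rfl, a, fun s hs ↦ ?_⟩
    have h := ha ⟨(s : absoluteGaloisGroup K), Subgroup.mem_inf.2 ⟨s.2, Subgroup.mem_subgroupOf.1 hs⟩⟩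
    have e : Subgroup.inclusion (inf_le_left : H ⊓ D ≤ H)
        ⟨(s : absoluteGaloisGroup K), Subgroup.mem_inf.2 ⟨s.2, Subgroup.mem_subgroupOf.1 hs⟩⟩ = s := Subtype.ext rfl
    rw [e] at h
    exact h
  obtain ⟨ψ, hψ, h0⟩ := exists_oneCocycleClass_eq_and_forall_mem_eq_zero hX (D.subgroupOf H) hφ
  exact ⟨ψ, hψ, fun g hg ↦ h0 g (Subgroup.mem_subgroupOf.2 hg)⟩

omit [NumberField K] in
/-- **B3 (the Kummer identity with the zero point).** For a representative `ψ` vanishing on the image of the local Galois group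
`r : G_v → H`, any read-out `Θ` with `Θ 0 = 0` into points `P` satisfies `Θ (ψ (r τ)) = τ • 0 − 0` — the shape of RSL_g's
clause (3) `pointsMapOfEmb (Θ v hv (φ.1 (resGalSubgroupOfEmb … τ)) i) = τ • Q i − Q i` with `Q = 0` (and `2^k • 0` lies in
every subgroup). [cite: Greenberg1989, §1 p. 98] -/
theorem kummer_identity_zero_point {H : Subgroup (absoluteGaloisGroup K)} {Gv P : Type*} [Monoid Gv] [AddCommGroup P]
    [DistribMulAction Gv P] (ψ : contOneCocycles (discreteTopRep H M)) (r : Gv → H) (Θ : M → P) (hΘ : Θ 0 = 0)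
    (hψ : ∀ τ, ψ.1 (r τ) = 0) (τ : Gv) : Θ (ψ.1 (r τ)) = τ • (0 : P) - 0 := by
  rw [hψ, hΘ, smul_zero, sub_zero]

end Generic

/-! ## §1 The transfer map `τ_{n,N} = res_{Γ_∞ ≤ Γ_n} ∘ (A_ρ[N] ↪ A_ρ)_*` -/

variable {p : ℕ} [Fact p.Prime] (S : Set (PadicAlgCl p)) {d : ℕ} (ρ : FramedGaloisRep ℚ ↥(padicCoeffIntegers S) d)
  (κ : ZpExtension ℚ p) (N : ℤ) (n : ℕ)

/-- The inclusion `A_ρ[N] ↪ A_ρ` is `Γ_ℚ`-equivariant. [cite: SerreGaloisCohomology1997, I §2.1] -/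
theorem torsionBy_subtype_smul (g : absoluteGaloisGroup ℚ) (x : ↥(AddSubgroup.torsionBy (Cofree ρ ↥(padicCoeffField S)) N)) :
    (AddSubgroup.torsionBy (Cofree ρ ↥(padicCoeffField S)) N).subtype (g • x) =
      g • (AddSubgroup.torsionBy (Cofree ρ ↥(padicCoeffField S)) N).subtype x :=
  rfl

/-! ## §2 T1 [unr]: admissible ⟹ `τ b ∈ unramifiedOutside Γ_∞ A_ρ p S₀` -/

/-- **L1 (Kato ⟹ Greenberg–Vatsal; converse of `ThetaTransport.admissible_of_mem_unramifiedOutside`).** A class of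
`H¹(H, A_ρ[N])` (`H` normal) dying on `H ⊓ I_𝔓` for EVERY prime `𝔓 ∣ v`, `v ∉ S'`, lies in
`unramifiedOutside H A_ρ[N] p S₀` as soon as `S' ⊆ S₀ ∪ {v ∣ p}`: «unramified» is `Γ_ℚ`-stable in the all-primes form
(`forall_resLe_inf_inertia_conjMap_eq_zero`), `GreenbergSelmer.inertia v = I_{𝔓₀(v)}`, and B1.
[cite: GreenbergVatsal2000, §2 pp. 16–17, 23] [cite: Kato2004Asterisque, §8.2 (p. 181)] [cite: NeukirchANT1999, Ch. II §9 (9.6)] -/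
theorem mem_unramifiedOutside_of_admissible (H : Subgroup (absoluteGaloisGroup ℚ)) [H.Normal]
    {S₀ S' : Set (HeightOneSpectrum (𝓞 ℚ))} (hS' : S' ⊆ S₀ ∪ {v | ((p : ℕ) : 𝓞 ℚ) ∈ v.asIdeal})
    {c : subgroupH1 H ↥(AddSubgroup.torsionBy (Cofree ρ ↥(padicCoeffField S)) N)}
    (hc : ∀ v ∉ S', ∀ 𝔓 ∈ v.primesAbove,
      resLe (cofreeTorsionGaloisModule S ρ N).toTopRep (inf_le_left : H ⊓ 𝔓.inertia (absoluteGaloisGroup ℚ) ≤ H) 1 c = 0) :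
    c ∈ unramifiedOutside H ↥(AddSubgroup.torsionBy (Cofree ρ ↥(padicCoeffField S)) N) p S₀ := by
  rw [GreenbergVatsal2000.mem_unramifiedOutside_iff]
  intro v hvS hvp σ
  have hv : v ∉ S' := fun h ↦ (hS' h).elim hvS hvp
  -- all primes above `v`: `conj_σ c` dies on `H ⊓ I_{𝔓₀(v)}` (Kato's dialect `resLe`/`conjMap`, definitionally `resOfLe`/`conjH1`)
  have h1 := forall_resLe_inf_inertia_conjMap_eq_zero (cofreeTorsionGaloisModule S ρ N).toTopRep H v σ (hc v hv)
    (adicCompletionPrime ℚ v) (adicCompletionPrime_mem_primesAbove ℚ v)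
  refine mem_unramifiedKer_of_resOfLe_inertia_inf_eq_zero H v (I := (adicCompletionPrime ℚ v).inertia (absoluteGaloisGroup ℚ))
    ?_ h1
  rw [inertia_adicCompletionPrime_eq_map_absInertia ℚ v]
  exact le_rfl

variable {S₀ S' : Set (HeightOneSpectrum (𝓞 ℚ))}

/-- **T1 [unr].** An admissible level class transfers into clause (1) of the relaxed Selmer set over `ℚ_∞`:
`τ_{n,N} b ∈ unramifiedOutside Γ_∞ A_ρ p S₀`. [cite: GreenbergVatsal2000, §2 pp. 16–17, 23] [cite: SerreGaloisCohomology1997, I §2.4] -/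
theorem transferH1_mem_unramifiedOutside (hS' : S' ⊆ S₀ ∪ {v | ((p : ℕ) : 𝓞 ℚ) ∈ v.asIdeal})
    {b : subgroupH1 (κ.layerSubgroup n) ↥(AddSubgroup.torsionBy (Cofree ρ ↥(padicCoeffField S)) N)}
    (hb : ∀ v ∉ S', ∀ 𝔓 ∈ v.primesAbove, resLe (cofreeTorsionGaloisModule S ρ N).toTopRep
      (inf_le_left : κ.layerSubgroup n ⊓ 𝔓.inertia (absoluteGaloisGroup ℚ) ≤ κ.layerSubgroup n) 1 b = 0) :
    (resOfLe (Cofree ρ ↥(padicCoeffField S)) (κ.kerSubgroup_le_layerSubgroup n) (pushH1 (κ.layerSubgroup n) (AddSubgroup.torsionBy (Cofree ρ ↥(padicCoeffField S)) N).subtype (torsionBy_subtype_smul S ρ N) b)) ∈ unramifiedOutside κ.kerSubgroup (Cofree ρ ↥(padicCoeffField S)) p S₀ :=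
  ResidualLayer.resOfLe_mem_unramifiedOutside p S₀ (κ.kerSubgroup_le_layerSubgroup n)
    (ThetaTransport.pushH1_mem_unramifiedOutside _ (torsionBy_subtype_smul S ρ N) p S₀
      (mem_unramifiedOutside_of_admissible S ρ N (κ.layerSubgroup n) hS' hb))

/-! ## §3 T2 [inf] and T3 [at `p`]: local triviality of all conjugates transfers -/

/-- **RES-PUSH-ZERO for `τ`.** If `conj_σ b` dies on `Γ_n ⊓ D` then `conj_σ (τ b)` dies on `Γ_∞ ⊓ D`.
[cite: NeukirchSchmidtWingberg2008, I §5] -/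
theorem resOfLe_inf_conjH1_transferH1_eq_zero (D : Subgroup (absoluteGaloisGroup ℚ)) (σ : absoluteGaloisGroup ℚ)
    (b : subgroupH1 (κ.layerSubgroup n) ↥(AddSubgroup.torsionBy (Cofree ρ ↥(padicCoeffField S)) N))
    (hb : resOfLe ↥(AddSubgroup.torsionBy (Cofree ρ ↥(padicCoeffField S)) N)
      (inf_le_left : κ.layerSubgroup n ⊓ D ≤ κ.layerSubgroup n)
      (conjH1 (κ.layerSubgroup n) ↥(AddSubgroup.torsionBy (Cofree ρ ↥(padicCoeffField S)) N) σ b) = 0) :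
    resOfLe (Cofree ρ ↥(padicCoeffField S)) (inf_le_left : κ.kerSubgroup ⊓ D ≤ κ.kerSubgroup)
      (conjH1 κ.kerSubgroup (Cofree ρ ↥(padicCoeffField S)) σ ((resOfLe (Cofree ρ ↥(padicCoeffField S)) (κ.kerSubgroup_le_layerSubgroup n) (pushH1 (κ.layerSubgroup n) (AddSubgroup.torsionBy (Cofree ρ ↥(padicCoeffField S)) N).subtype (torsionBy_subtype_smul S ρ N) b)))) = 0 := by
  rw [conjH1_resOfLe, ThetaTransport.conjH1_pushH1]
  exact resOfLe_inf_resOfLe_pushH1_eq_zero (κ.kerSubgroup_le_layerSubgroup n) D _ (torsionBy_subtype_smul S ρ N) hb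

/-- **T2 [inf].** (E1c) at level `Γ_n` ⟹ clause (2) over `ℚ_∞`: `conj_σ (τ b) ∈ infKer Γ_∞ A_ρ w`.
[cite: Greenberg1989, §1 p. 98 (3)] -/
theorem conjH1_transferH1_mem_infKer (w : InfinitePlace ℚ) (σ : absoluteGaloisGroup ℚ)
    (b : subgroupH1 (κ.layerSubgroup n) ↥(AddSubgroup.torsionBy (Cofree ρ ↥(padicCoeffField S)) N))
    (hb : resOfLe ↥(AddSubgroup.torsionBy (Cofree ρ ↥(padicCoeffField S)) N)
      (inf_le_left : κ.layerSubgroup n ⊓ GreenbergSelmer.decompInf w ≤ κ.layerSubgroup n)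
      (conjH1 (κ.layerSubgroup n) ↥(AddSubgroup.torsionBy (Cofree ρ ↥(padicCoeffField S)) N) σ b) = 0) :
    conjH1 κ.kerSubgroup (Cofree ρ ↥(padicCoeffField S)) σ ((resOfLe (Cofree ρ ↥(padicCoeffField S)) (κ.kerSubgroup_le_layerSubgroup n) (pushH1 (κ.layerSubgroup n) (AddSubgroup.torsionBy (Cofree ρ ↥(padicCoeffField S)) N).subtype (torsionBy_subtype_smul S ρ N) b))) ∈
      infKer κ.kerSubgroup (Cofree ρ ↥(padicCoeffField S)) w := by
  rw [GreenbergSelmer.infKer, AddMonoidHom.mem_ker]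
  exact resOfLe_inf_conjH1_transferH1_eq_zero S ρ κ N n _ σ b hb

/-- **T3 [at `p`] (item 7: «`loc₂ s = 0`», strongest Galois-side form).** (E1b) at `v` ⟹
`conj_σ (τ b) ∈ awayKer Γ_∞ A_ρ v` for every `σ`. [cite: Greenberg1989, §1 p. 98] [cite: EmertonPollackWeston2006, §3.1] -/
theorem conjH1_transferH1_mem_awayKer (v : HeightOneSpectrum (𝓞 ℚ)) (σ : absoluteGaloisGroup ℚ)
    (b : subgroupH1 (κ.layerSubgroup n) ↥(AddSubgroup.torsionBy (Cofree ρ ↥(padicCoeffField S)) N))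
    (hb : resOfLe ↥(AddSubgroup.torsionBy (Cofree ρ ↥(padicCoeffField S)) N)
      (inf_le_left : κ.layerSubgroup n ⊓ GreenbergSelmer.decomp v ≤ κ.layerSubgroup n)
      (conjH1 (κ.layerSubgroup n) ↥(AddSubgroup.torsionBy (Cofree ρ ↥(padicCoeffField S)) N) σ b) = 0) :
    conjH1 κ.kerSubgroup (Cofree ρ ↥(padicCoeffField S)) σ ((resOfLe (Cofree ρ ↥(padicCoeffField S)) (κ.kerSubgroup_le_layerSubgroup n) (pushH1 (κ.layerSubgroup n) (AddSubgroup.torsionBy (Cofree ρ ↥(padicCoeffField S)) N).subtype (torsionBy_subtype_smul S ρ N) b))) ∈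
      awayKer κ.kerSubgroup (Cofree ρ ↥(padicCoeffField S)) v := by
  rw [GreenbergSelmer.awayKer, AddMonoidHom.mem_ker]
  exact resOfLe_inf_conjH1_transferH1_eq_zero S ρ κ N n _ σ b hb

/-- **Item 7, clauses (3)/(3♭) come for free.** Under (E1b) at `v`, `conj_σ (τ b)` has a representative cocycle VANISHING on
`Γ_∞ ∩ D_v` (B2 with `isOpen_stabilizer_cofree`); by B3 the Kummer identity of RSL_g's clause (3) then holds with the zero points
`Q = 0` (pins `Θ`, `pointsMapOfEmb`, `resGalSubgroupOfEmb` — whose image lies in `Γ_∞ ∩ D_v` up to the conjugation already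
quantified — are the lead's; not typed here). [cite: SerreGaloisCohomology1997, I §2.6 (b)] [cite: Greenberg1989, §1 p. 98] -/
theorem exists_rep_vanishing_conjH1_transferH1 (v : HeightOneSpectrum (𝓞 ℚ)) (σ : absoluteGaloisGroup ℚ)
    (b : subgroupH1 (κ.layerSubgroup n) ↥(AddSubgroup.torsionBy (Cofree ρ ↥(padicCoeffField S)) N))
    (hb : resOfLe ↥(AddSubgroup.torsionBy (Cofree ρ ↥(padicCoeffField S)) N)
      (inf_le_left : κ.layerSubgroup n ⊓ GreenbergSelmer.decomp v ≤ κ.layerSubgroup n)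
      (conjH1 (κ.layerSubgroup n) ↥(AddSubgroup.torsionBy (Cofree ρ ↥(padicCoeffField S)) N) σ b) = 0) :
    ∃ ψ : contOneCocycles (discreteTopRep κ.kerSubgroup (Cofree ρ ↥(padicCoeffField S))),
      oneCocycleClass _ ψ = conjH1 κ.kerSubgroup (Cofree ρ ↥(padicCoeffField S)) σ ((resOfLe (Cofree ρ ↥(padicCoeffField S)) (κ.kerSubgroup_le_layerSubgroup n) (pushH1 (κ.layerSubgroup n) (AddSubgroup.torsionBy (Cofree ρ ↥(padicCoeffField S)) N).subtype (torsionBy_subtype_smul S ρ N) b))) ∧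
      ∀ g : κ.kerSubgroup, (g : absoluteGaloisGroup ℚ) ∈ GreenbergSelmer.decomp v → ψ.1 g = 0 :=
  exists_rep_vanishing_of_resOfLe_inf_eq_zero κ.kerSubgroup (GreenbergSelmer.decomp v) (isOpen_stabilizer_cofree S ρ)
    (resOfLe_inf_conjH1_transferH1_eq_zero S ρ κ N n _ σ b hb)

/-! ## §4 (T)_ρ assembled -/

/-- **(T)_ρ for items 6 and 7.** A level-`(n,N)` class that is admissible outside `S' ⊆ S₀ ∪ {v ∣ p}` (E1a) and all of
whose conjugates die on `Γ_n ∩ D_w` for every infinite `w` (E1c) transfers into the RELAXED Selmer set over `ℚ_∞`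
(clauses (1) ∧ (2) of RSL_g's counted set, verbatim). [cite: GreenbergVatsal2000, §2] [cite: Greenberg1989, §1 p. 98 (3)] [cite: PerrinRiou1995Asterisque, §1.3] -/
theorem transferH1_mem_relaxed (hS' : S' ⊆ S₀ ∪ {v | ((p : ℕ) : 𝓞 ℚ) ∈ v.asIdeal})
    (b : subgroupH1 (κ.layerSubgroup n) ↥(AddSubgroup.torsionBy (Cofree ρ ↥(padicCoeffField S)) N))
    (hE1a : ∀ v ∉ S', ∀ 𝔓 ∈ v.primesAbove, resLe (cofreeTorsionGaloisModule S ρ N).toTopRep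
      (inf_le_left : κ.layerSubgroup n ⊓ 𝔓.inertia (absoluteGaloisGroup ℚ) ≤ κ.layerSubgroup n) 1 b = 0)
    (hE1c : ∀ (w : InfinitePlace ℚ) (σ : absoluteGaloisGroup ℚ),
      resOfLe ↥(AddSubgroup.torsionBy (Cofree ρ ↥(padicCoeffField S)) N)
        (inf_le_left : κ.layerSubgroup n ⊓ GreenbergSelmer.decompInf w ≤ κ.layerSubgroup n)
        (conjH1 (κ.layerSubgroup n) ↥(AddSubgroup.torsionBy (Cofree ρ ↥(padicCoeffField S)) N) σ b) = 0) :
    (resOfLe (Cofree ρ ↥(padicCoeffField S)) (κ.kerSubgroup_le_layerSubgroup n) (pushH1 (κ.layerSubgroup n) (AddSubgroup.torsionBy (Cofree ρ ↥(padicCoeffField S)) N).subtype (torsionBy_subtype_smul S ρ N) b)) ∈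
      {y : subgroupH1 κ.kerSubgroup (Cofree ρ ↥(padicCoeffField S)) |
        y ∈ unramifiedOutside κ.kerSubgroup (Cofree ρ ↥(padicCoeffField S)) p S₀ ∧
        ∀ w σ, conjH1 κ.kerSubgroup (Cofree ρ ↥(padicCoeffField S)) σ y ∈
          infKer κ.kerSubgroup (Cofree ρ ↥(padicCoeffField S)) w} :=
  ⟨transferH1_mem_unramifiedOutside S ρ κ N n hS' hE1a,
    fun w σ ↦ conjH1_transferH1_mem_infKer S ρ κ N n w σ _ (hE1c w σ)⟩

/-- **(T)_ρ for item 7 (strict at `p`).** Adding (E1b) at the places `v ∣ p`, the transferred class is moreover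
trivial at `p` in the strongest sense: every conjugate lies in `awayKer Γ_∞ A_ρ v` — so any pinned `loc₂`
(restriction along a decomposition group above `2` inside `Γ_∞`) vanishes on it.
[cite: Greenberg1989, §1 p. 98] [cite: MilneADT2006, I 4.10 (b)] -/
theorem transferH1_mem_relaxed_strict (hS' : S' ⊆ S₀ ∪ {v | ((p : ℕ) : 𝓞 ℚ) ∈ v.asIdeal})
    (b : subgroupH1 (κ.layerSubgroup n) ↥(AddSubgroup.torsionBy (Cofree ρ ↥(padicCoeffField S)) N))
    (hE1a : ∀ v ∉ S', ∀ 𝔓 ∈ v.primesAbove, resLe (cofreeTorsionGaloisModule S ρ N).toTopRep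
      (inf_le_left : κ.layerSubgroup n ⊓ 𝔓.inertia (absoluteGaloisGroup ℚ) ≤ κ.layerSubgroup n) 1 b = 0)
    (hE1c : ∀ (w : InfinitePlace ℚ) (σ : absoluteGaloisGroup ℚ),
      resOfLe ↥(AddSubgroup.torsionBy (Cofree ρ ↥(padicCoeffField S)) N)
        (inf_le_left : κ.layerSubgroup n ⊓ GreenbergSelmer.decompInf w ≤ κ.layerSubgroup n)
        (conjH1 (κ.layerSubgroup n) ↥(AddSubgroup.torsionBy (Cofree ρ ↥(padicCoeffField S)) N) σ b) = 0)
    (hE1b : ∀ (v : HeightOneSpectrum (𝓞 ℚ)), ((p : ℕ) : 𝓞 ℚ) ∈ v.asIdeal → ∀ σ : absoluteGaloisGroup ℚ,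
      resOfLe ↥(AddSubgroup.torsionBy (Cofree ρ ↥(padicCoeffField S)) N)
        (inf_le_left : κ.layerSubgroup n ⊓ GreenbergSelmer.decomp v ≤ κ.layerSubgroup n)
        (conjH1 (κ.layerSubgroup n) ↥(AddSubgroup.torsionBy (Cofree ρ ↥(padicCoeffField S)) N) σ b) = 0) :
    (resOfLe (Cofree ρ ↥(padicCoeffField S)) (κ.kerSubgroup_le_layerSubgroup n) (pushH1 (κ.layerSubgroup n) (AddSubgroup.torsionBy (Cofree ρ ↥(padicCoeffField S)) N).subtype (torsionBy_subtype_smul S ρ N) b)) ∈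
      {y : subgroupH1 κ.kerSubgroup (Cofree ρ ↥(padicCoeffField S)) |
        y ∈ unramifiedOutside κ.kerSubgroup (Cofree ρ ↥(padicCoeffField S)) p S₀ ∧
        (∀ w σ, conjH1 κ.kerSubgroup (Cofree ρ ↥(padicCoeffField S)) σ y ∈
          infKer κ.kerSubgroup (Cofree ρ ↥(padicCoeffField S)) w) ∧
        ∀ v, ((p : ℕ) : 𝓞 ℚ) ∈ v.asIdeal → ∀ σ, conjH1 κ.kerSubgroup (Cofree ρ ↥(padicCoeffField S)) σ y ∈
          awayKer κ.kerSubgroup (Cofree ρ ↥(padicCoeffField S)) v} :=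
  ⟨transferH1_mem_unramifiedOutside S ρ κ N n hS' hE1a,
    fun w σ ↦ conjH1_transferH1_mem_infKer S ρ κ N n w σ _ (hE1c w σ),
    fun v hv σ ↦ conjH1_transferH1_mem_awayKer S ρ κ N n v σ _ (hE1b v hv σ)⟩

/-! ## §4b From the DUAL SELMER STRUCTURE at level `(n,N)` (Shapiro model over `K = ℚ`, S52/S53) to the relaxed set over `ℚ_∞`

The composite with the landed `…CofreeShapiroTransport` §2–§3: the hypotheses are now LOCAL CONDITIONS on the global Shapiro lift
`Sh c ∈ H¹(ℚ, Maps(Γ_ℚ ⧸ Γ_n, A_ρ[N]))` — unramified at the finite `w ∉ S₀ ∪ {p}`, zero at the infinite place(s) [and zero at `v ∣ p`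
for item 7] — i.e. membership of `Sh c` in the DUAL structure of the level-`(n,N)` `SelmerComplement` call (relaxed at `S₀`, hence no
hypothesis there).  On the RSL_g habitat `S₀ ⊇ {v : ℓ_v ∣ M} ∪ {bad places of W}` and `ρ` is unramified at `ℓ ∤ 2M`, so `hρ` holds. -/

section Shapiro

open Literature.NumberTheory.GaloisRepresentations.DiscreteGaloisModule Literature.NumberTheory.GaloisCohomology

variable [Fintype (absoluteGaloisGroup ℚ ⧸ κ.layerSubgroup n)]
  {s : absoluteGaloisGroup ℚ ⧸ κ.layerSubgroup n → absoluteGaloisGroup ℚ}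
  (hs : ∀ x : absoluteGaloisGroup ℚ ⧸ κ.layerSubgroup n, (s x : absoluteGaloisGroup ℚ ⧸ κ.layerSubgroup n) = x)
  (hs1 : s ((1 : absoluteGaloisGroup ℚ) : absoluteGaloisGroup ℚ ⧸ κ.layerSubgroup n) = 1)

/-- **Dual structure ⟹ relaxed set (items 6 and 7).** [cite: NeukirchSchmidtWingberg2008, I §6 Prop. (1.6.4)] [cite: MilneADT2006, I §4]
[cite: GreenbergVatsal2000, §2 pp. 16–17, 23] [cite: Greenberg1989, §1 p. 98 (3)] -/
theorem transferH1_mem_relaxed_of_shapiroLift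
    (hρ : ∀ w : HeightOneSpectrum (𝓞 ℚ), w ∉ S₀ → ((p : ℕ) : 𝓞 ℚ) ∉ w.asIdeal → ρ.IsUnramifiedAt w)
    (c : H1 (cofreeTorsionGaloisModule S ρ N) (κ.layerSubgroup n))
    (hur : ∀ w : HeightOneSpectrum (𝓞 ℚ), w ∉ S₀ → ((p : ℕ) : 𝓞 ℚ) ∉ w.asIdeal →
      galoisCohomology.localization
          ((cofreeTorsionGaloisModule S ρ N).coind (κ.layerSubgroup n) (κ.isOpen_layerSubgroup n)) (Sum.inr w) 1
          (shapiroLift (cofreeTorsionGaloisModule S ρ N).toTopRep (κ.layerSubgroup n) (κ.isOpen_layerSubgroup n) hs hs1 c) ∈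
        unramifiedSubgroup (GaloisRep.toLocal w
          ((cofreeTorsionGaloisModule S ρ N).coind (κ.layerSubgroup n) (κ.isOpen_layerSubgroup n))) 1)
    (hinf : ∀ w : InfinitePlace ℚ,
      galoisCohomology.localization
          ((cofreeTorsionGaloisModule S ρ N).coind (κ.layerSubgroup n) (κ.isOpen_layerSubgroup n)) (Sum.inl w) 1
          (shapiroLift (cofreeTorsionGaloisModule S ρ N).toTopRep (κ.layerSubgroup n) (κ.isOpen_layerSubgroup n) hs hs1 c) = 0) :
    (resOfLe (Cofree ρ ↥(padicCoeffField S)) (κ.kerSubgroup_le_layerSubgroup n) (pushH1 (κ.layerSubgroup n) (AddSubgroup.torsionBy (Cofree ρ ↥(padicCoeffField S)) N).subtype (torsionBy_subtype_smul S ρ N) c)) ∈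
      {y : subgroupH1 κ.kerSubgroup (Cofree ρ ↥(padicCoeffField S)) |
        y ∈ unramifiedOutside κ.kerSubgroup (Cofree ρ ↥(padicCoeffField S)) p S₀ ∧
        ∀ w σ, conjH1 κ.kerSubgroup (Cofree ρ ↥(padicCoeffField S)) σ y ∈
          infKer κ.kerSubgroup (Cofree ρ ↥(padicCoeffField S)) w} := by
  refine transferH1_mem_relaxed S ρ κ N n (S' := S₀ ∪ {v | ((p : ℕ) : 𝓞 ℚ) ∈ v.asIdeal}) subset_rfl c ?_ fun w σ ↦ ?_
  · refine ThetaTransport.ShapiroTransport.admissible_of_forall_localization_shapiroLift_mem S ρ κ N n hs hs1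
      (fun w hw ↦ ?_) c (fun w hw ↦ ?_)
    · simp only [Set.mem_union, Set.mem_setOf_eq, not_or] at hw
      exact ⟨hw.2, hρ w hw.1 hw.2⟩
    · simp only [Set.mem_union, Set.mem_setOf_eq, not_or] at hw
      exact hur w hw.1 hw.2
  · exact ThetaTransport.ShapiroTransport.resOfLe_decompInf_conjH1_eq_zero_of_localization_shapiroLift_eq_zero S ρ N κ n hs hs1
      w c (hinf w) σ

/-- **Dual structure ⟹ relaxed set, strict at `p` (item 7).** [cite: NeukirchSchmidtWingberg2008, I §6 Prop. (1.6.4)]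
[cite: Greenberg1989, §1 p. 98] [cite: MilneADT2006, I 4.10 (b)] -/
theorem transferH1_mem_relaxed_strict_of_shapiroLift
    (hρ : ∀ w : HeightOneSpectrum (𝓞 ℚ), w ∉ S₀ → ((p : ℕ) : 𝓞 ℚ) ∉ w.asIdeal → ρ.IsUnramifiedAt w)
    (c : H1 (cofreeTorsionGaloisModule S ρ N) (κ.layerSubgroup n))
    (hur : ∀ w : HeightOneSpectrum (𝓞 ℚ), w ∉ S₀ → ((p : ℕ) : 𝓞 ℚ) ∉ w.asIdeal →
      galoisCohomology.localization
          ((cofreeTorsionGaloisModule S ρ N).coind (κ.layerSubgroup n) (κ.isOpen_layerSubgroup n)) (Sum.inr w) 1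
          (shapiroLift (cofreeTorsionGaloisModule S ρ N).toTopRep (κ.layerSubgroup n) (κ.isOpen_layerSubgroup n) hs hs1 c) ∈
        unramifiedSubgroup (GaloisRep.toLocal w
          ((cofreeTorsionGaloisModule S ρ N).coind (κ.layerSubgroup n) (κ.isOpen_layerSubgroup n))) 1)
    (hinf : ∀ w : InfinitePlace ℚ,
      galoisCohomology.localization
          ((cofreeTorsionGaloisModule S ρ N).coind (κ.layerSubgroup n) (κ.isOpen_layerSubgroup n)) (Sum.inl w) 1
          (shapiroLift (cofreeTorsionGaloisModule S ρ N).toTopRep (κ.layerSubgroup n) (κ.isOpen_layerSubgroup n) hs hs1 c) = 0)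
    (hp : ∀ v : HeightOneSpectrum (𝓞 ℚ), ((p : ℕ) : 𝓞 ℚ) ∈ v.asIdeal →
      galoisCohomology.localization
          ((cofreeTorsionGaloisModule S ρ N).coind (κ.layerSubgroup n) (κ.isOpen_layerSubgroup n)) (Sum.inr v) 1
          (shapiroLift (cofreeTorsionGaloisModule S ρ N).toTopRep (κ.layerSubgroup n) (κ.isOpen_layerSubgroup n) hs hs1 c) = 0) :
    (resOfLe (Cofree ρ ↥(padicCoeffField S)) (κ.kerSubgroup_le_layerSubgroup n) (pushH1 (κ.layerSubgroup n) (AddSubgroup.torsionBy (Cofree ρ ↥(padicCoeffField S)) N).subtype (torsionBy_subtype_smul S ρ N) c)) ∈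
      {y : subgroupH1 κ.kerSubgroup (Cofree ρ ↥(padicCoeffField S)) |
        y ∈ unramifiedOutside κ.kerSubgroup (Cofree ρ ↥(padicCoeffField S)) p S₀ ∧
        (∀ w σ, conjH1 κ.kerSubgroup (Cofree ρ ↥(padicCoeffField S)) σ y ∈
          infKer κ.kerSubgroup (Cofree ρ ↥(padicCoeffField S)) w) ∧
        ∀ v, ((p : ℕ) : 𝓞 ℚ) ∈ v.asIdeal → ∀ σ, conjH1 κ.kerSubgroup (Cofree ρ ↥(padicCoeffField S)) σ y ∈
          awayKer κ.kerSubgroup (Cofree ρ ↥(padicCoeffField S)) v} := by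
  obtain ⟨h1, h2⟩ := transferH1_mem_relaxed_of_shapiroLift S ρ κ N n hs hs1 hρ c hur hinf
  exact ⟨h1, h2, fun v hv σ ↦ conjH1_transferH1_mem_awayKer S ρ κ N n v σ _
    (ThetaTransport.ShapiroTransport.resOfLe_decomp_conjH1_eq_zero_of_localization_shapiroLift_eq_zero S ρ N κ n hs hs1
      v c (hp v hv) σ)⟩

end Shapiro

/-! ## §5 The transferred classes are `N`-torsion -/

/-- `N • (τ b) = 0`: `τ` is additive and `N • b = 0` in `H¹(Γ_n, A_ρ[N])` (the coefficients are killed by `N`).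
[cite: SerreGaloisCohomology1997, I §2.2] -/
theorem zsmul_transferH1_eq_zero (b : subgroupH1 (κ.layerSubgroup n) ↥(AddSubgroup.torsionBy (Cofree ρ ↥(padicCoeffField S)) N))
    (hb : N • b = 0) : N • (resOfLe (Cofree ρ ↥(padicCoeffField S)) (κ.kerSubgroup_le_layerSubgroup n) (pushH1 (κ.layerSubgroup n) (AddSubgroup.torsionBy (Cofree ρ ↥(padicCoeffField S)) N).subtype (torsionBy_subtype_smul S ρ N) b)) = 0 := by
  rw [← map_zsmul, ← map_zsmul, hb, map_zero, map_zero]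

end Summit.BirchSwinnertonDyer.BirchSwinnertonDyer.Theorems.ThetaTransport.CofreeSelmerTransfer

end
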